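import Mathlib
import HarnessLib
import Summits.HubbardSuperconductivity.HubbardSuperconductivity.Theorems.KLProgrammeKLRegimeEngineScaleZeroTwoLegGridSumsWeights
import Summits.HubbardSuperconductivity.HubbardSuperconductivity.Theorems.KLProgrammeKLRegimeEngineScaleZeroTwoLegGridVertexSq
import Summits.HubbardSuperconductivity.HubbardSuperconductivity.Theorems.KLProgrammeKLRegimeEngineScaleZeroCovariance
import Summits.HubbardSuperconductivity.HubbardSuperconductivity.Theorems.KLProgrammeKLRegimeEngineScaleZeroValuesExplicit
import Summits.HubbardSuperconductivity.HubbardSuperconductivity.Theorems.KLProgrammeKLRegimeEngineScaleZeroE1Regime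
import Summits.HubbardSuperconductivity.HubbardSuperconductivity.Theorems.KLProgrammeKLRegimeEngineScaleZeroNorms
import Summits.HubbardSuperconductivity.HubbardSuperconductivity.Theorems.KLProgrammeKLRegimeSplitGlue

/-!
# K3 gen-7F (K3-FLOW RULING F, KL STATUS l.2548), engine-flow child, stub (M) AT THE BARE FRAME `K₀ = 0`: the pinned grid sums of the
# scale-`0` two-leg kernel at EVERY moment order, in closed form modulo the weighted covariance moments

Cell gate-hubbard-kl, seat p1b (g8).  At `K₀ = 0` the scale-`0` output is `W₀ = effAction (S_{4M}ᵀ C⁰_{>e₀} S_{4M}) V_{4M}`: no counterterm vertex, no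
counterterm chain, ultralocal quartic vertex (weighted pinned profile `|U||β|/N` in degree `4` for EVERY tree weight), BARE covariance.  p3 g7's
determinant-bounded two-leg machinery (`…TwoLegGridSums[Weights]`) is run here at the bare frame and at every moment order `k` (weights `(1+diam)ᵏ`,
constant `2ᵏ`; p3 had `k ≤ 2`): §1–§2 `twoLeg_offDiag_moment_pow_sum_le` (any frame); §3 the bare-frame vertex profiles; §4 the CLOSED FORMS ([tree] `klFrameOK_zeroC`: the bare frame
is admissible on `klWindowC`) at `κ₀ = ρ = √(2(7+1606732))` ([tree] `isGramBoundedR_scaleZero_of_frameOK`),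
`α = 4M·klScaleZeroA0/β` ([tree] `rowSum/colSum_scaleZero_le_A0`): **`twoLeg_plain_point_sum_frameZero_le`** (`B₀ ≤ (64/3)e⁹κ₀²|U|·β/(4M)`),
**`twoLeg_offDiag_moment_pow_sum_frameZero_le`** (`Bₖ ≤ 2^{k+9}e¹⁸κ₀⁴·a·U²·β/(4M)` for the normalised `(1+diam)ᵏ`-weighted covariance size
`a = αₖβ/(4M)`, `θ = 16e⁹κ₀²a|U| ≤ 1/2`), **`twoLeg_time_sum_frameZero_le`** (`Bᵗ`, same at `k = 1`, circular time weight).  The momentum sizes of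
`I_L[σ₀]` and `|z₀ − 1|` follow by `…TwoLegMomentsFromGridAll`; the angular jets of `ν₀(0)` by [tree] `abs_iteratedDeriv_comp_fermiPointLp_le_struct`.
Everything is PROVED; no definitions.  References: BGM 2006 (2.77)–(2.80), §3 (3.2)–(3.3) [cite: BenfattoGiulianiMastropietro2006];
Pedra–Salmhofer 2008 Thm 2.4 [cite: PedraSalmhofer2008].
-/

noncomputable section

namespace Summit.HubbardSuperconductivity.HubbardSuperconductivity.Theorems.EngineV8

set_option linter.dupNamespace false -- summit = problem name (single-conjunct summit), D-0017

open Real Finset Literature.MathematicalPhysics.QuantumLattice Literature.Probability.LatticeModels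
open Literature.Probability.LatticeModels.BattleFederbush GrassmannAlgebra
open Summit.HubbardSuperconductivity.HubbardSuperconductivity.Theorems.KLRegimeSplit
open Summit.HubbardSuperconductivity.HubbardSuperconductivity.Theorems.DispersionFlow

variable {L N : ℕ} [NeZero L] [NeZero N]

/-! ## §1 The off-diagonal moment weight of order `k` against the tree weight `(1 + diam)ᵏ` -/

/-- **The off-diagonal `k`-th moment weight is dominated by `2ᵏ` times the `k`-th power pair weight**:
`[x⃗₁ ≠ x⃗₀]·(1 + |Δx̃₀| + |Δx̃₁|)ᵏ ≤ 2ᵏ·(1 + diam)ᵏ` (`β′ ≥ 0`). -/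
theorem offDiagMomentWeight_pow_le_two_pow_mul_polyWt {β' : ℝ} (hβ' : 0 ≤ β') (k : ℕ) (Y : Fin 2 → GridLeg (GridPoint L N)) :
    (if (Y 1).1.1.2 - (Y 0).1.1.2 = 0 then (0 : ℝ) else
      (1 + ((((Y 1).1.1.2 - (Y 0).1.1.2) 0).valMinAbs.natAbs : ℝ) + ((((Y 1).1.1.2 - (Y 0).1.1.2) 1).valMinAbs.natAbs : ℝ)) ^ k) ≤
      (2 : ℝ) ^ k * diamWeight (fun s => (1 + 1 * s) ^ k) (gridLabelDist L N β') ((univ.image Y).image gridLegPos) := by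
  have h0 := natAbs_valMinAbs_sub_le_torusSiteDist (Y 0).1.1.2 (Y 1).1.1.2 0
  have h1 := natAbs_valMinAbs_sub_le_torusSiteDist (Y 0).1.1.2 (Y 1).1.1.2 1
  have hd : torusSiteDist (Y 0).1.1.2 (Y 1).1.1.2 ≤ labelDiam (gridLabelDist L N β') ((univ.image Y).image gridLegPos) := by
    refine (torusSiteDist_le_gridLabelDist_gridLegPos hβ' Y).trans ?_
    rw [Finset.image_image]
    exact le_labelDiam _ (mem_image_of_mem _ (mem_univ 0)) (mem_image_of_mem _ (mem_univ 1))
  have hD0 : 0 ≤ labelDiam (gridLabelDist L N β') ((univ.image Y).image gridLegPos) := labelDiam_nonneg _ _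
  have ha0 : (0 : ℝ) ≤ ((((Y 1).1.1.2 - (Y 0).1.1.2) 0).valMinAbs.natAbs : ℝ) := Nat.cast_nonneg _
  have ha1 : (0 : ℝ) ≤ ((((Y 1).1.1.2 - (Y 0).1.1.2) 1).valMinAbs.natAbs : ℝ) := Nat.cast_nonneg _
  rw [diamWeight, one_mul, ← mul_pow]
  split_ifs
  · positivity
  · exact pow_le_pow_left₀ (by positivity) (by linarith) k

/-- `wtₖ(S) = (1 + diam (S.image gridLegPos))ᵏ` is a tree weight (`β′ ≥ 0`). -/
theorem isTreeWeight_polyWt {β' : ℝ} (hβ' : 0 ≤ β') (k : ℕ) :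
    IsTreeWeight (fun S : Finset (GridLeg (GridPoint L N)) =>
      diamWeight (fun s => (1 + 1 * s) ^ k) (gridLabelDist L N β') (S.image gridLegPos)) :=
  (isTreeWeight_polyDiamWeight (isLabelDist_gridLabelDist L N hβ') zero_le_one k).comap gridLegPos

/-! ## §2 The off-diagonal weighted point sum at any frame and any order -/

/-- **THE OFF-DIAGONAL `k`-TH SPATIAL MOMENT** (`Bₖ`, any `k`, any frame `K`): with `wtₖ = (1 + diam)ᵏ`, its weighted covariance sizes `α` (row/column sums
of `‖C X Y‖·wtₖ{X,Y}`), the `wtₖ`-weighted vertex profile `Nw` and `θ = eα‖Ṽ‖_{h,wtₖ}/κ² < 1`: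
`Σ_{p₁} [x⃗₁ ≠ x⃗₀](1+|Δx̃₀|+|Δx̃₁|)ᵏ·‖kernel₂ (W − 𝒩_{K,N}) ((p₀,σ,+),(p₁,σ,−))‖ ≤ 2ᵏ·ρ⁻²·e‖Ṽ‖_{h,wtₖ}·θ/(1−θ)`. -/
theorem twoLeg_offDiag_moment_pow_sum_le (C : Matrix (GridLeg (GridPoint L N)) (GridLeg (GridPoint L N)) ℂ) (β U : ℝ) (K : TrigPolyC4v)
    (k : ℕ) {β' : ℝ} (hβ' : 0 ≤ β') {κ : ℝ} (hκ : 0 < κ) (hGB : IsGramBoundedR C κ) (Nw : ℕ → ℝ) (hNw0 : ∀ m', 0 ≤ Nw m')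
    (hNw : ∀ m' (j : Fin (2 * m')) (w : GridLeg (GridPoint L N)),
      ∑ Y ∈ univ.filter (fun Y : Fin (2 * m') → GridLeg (GridPoint L N) => Y j = w),
        ‖kernel ℂ (hubbardGridInteraction L N β U + hubbardGridCounterQuadratic L N β K) (2 * m') Y‖ *
          diamWeight (fun s => (1 + 1 * s) ^ k) (gridLabelDist L N β') ((univ.image Y).image gridLegPos) ≤ Nw m')
    {αw : ℝ} (hαw : 0 < αw)
    (hrow : ∀ X, ∑ Y, ‖C X Y‖ * diamWeight (fun s => (1 + 1 * s) ^ k) (gridLabelDist L N β') {gridLegPos X, gridLegPos Y} ≤ αw)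
    (hcol : ∀ Y, ∑ X, ‖C X Y‖ * diamWeight (fun s => (1 + 1 * s) ^ k) (gridLabelDist L N β') {gridLegPos X, gridLegPos Y} ≤ αw)
    {ρ : ℝ} (hρ : 0 < ρ) (hθ : Real.exp 1 * αw * normV (GridLeg (GridPoint L N)) κ ρ Nw / κ ^ 2 < 1)
    (σ : Fin 2) (p₀ : GridPoint L N) :
    ∑ p₁ : GridPoint L N, (if p₁.2 - p₀.2 = 0 then (0 : ℝ) else
        (1 + (((p₁.2 - p₀.2) 0).valMinAbs.natAbs : ℝ) + (((p₁.2 - p₀.2) 1).valMinAbs.natAbs : ℝ)) ^ k) *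
      ‖kernel ℂ (effAction ℂ C (hubbardGridInteraction L N β U + hubbardGridCounterQuadratic L N β K) -
          hubbardGridCounterQuadratic L N β K) 2 (fun i => ((![p₀, p₁] i, σ), i))‖ ≤
      (2 : ℝ) ^ k * (ρ⁻¹ ^ 2 * (Real.exp 1 * normV (GridLeg (GridPoint L N)) κ ρ Nw) *
        (Real.exp 1 * αw * normV (GridLeg (GridPoint L N)) κ ρ Nw / κ ^ 2) /
          (1 - Real.exp 1 * αw * normV (GridLeg (GridPoint L N)) κ ρ Nw / κ ^ 2)) := by
  set ω : (Fin 2 → GridLeg (GridPoint L N)) → ℝ := fun Y => if (Y 1).1.1.2 - (Y 0).1.1.2 = 0 then (0 : ℝ) else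
      (1 + ((((Y 1).1.1.2 - (Y 0).1.1.2) 0).valMinAbs.natAbs : ℝ) + ((((Y 1).1.1.2 - (Y 0).1.1.2) 1).valMinAbs.natAbs : ℝ)) ^ k with hω
  have hω0 : ∀ Y, 0 ≤ ω Y := fun Y => by rw [hω]; dsimp only; split_ifs <;> positivity
  have hpair : ∀ X Y : GridLeg (GridPoint L N), ({X, Y} : Finset (GridLeg (GridPoint L N))).image gridLegPos = {gridLegPos X, gridLegPos Y} :=
    fun X Y => by rw [image_insert, image_singleton]
  have h := twoLeg_offDiag_wsum_le_of_wgridStep C β U K (isTreeWeight_polyWt (L := L) (N := N) hβ' k) hκ hGB Nw hNw0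
    (fun m' j w => by simpa only [Finset.image_image] using hNw m' j w) hαw (fun X => by simpa only [hpair] using hrow X)
    (fun Y => by simpa only [hpair] using hcol Y) hρ hθ ω
    (fun Y hY => by simpa only [hω] using offDiagMomentWeight_eq_zero_of_point_eq k Y hY) (by positivity : (0 : ℝ) ≤ (2 : ℝ) ^ k)
    (fun Y => by simpa only [hω, Finset.image_image] using offDiagMomentWeight_pow_le_two_pow_mul_polyWt (L := L) (N := N) hβ' k Y)
    (((p₀, σ), 0))
  refine le_trans ?_ h
  refine le_trans (le_of_eq ?_) (sum_point_string_le_sum_pinned (fun Y => ω Y * ‖kernel ℂ (effAction ℂ C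
      (hubbardGridInteraction L N β U + hubbardGridCounterQuadratic L N β K) - hubbardGridCounterQuadratic L N β K) 2 Y‖)
      (fun Y => mul_nonneg (hω0 Y) (norm_nonneg _)) σ p₀)
  refine sum_congr rfl fun p₁ _ => ?_
  simp only [hω, Matrix.cons_val_zero, Matrix.cons_val_one, Matrix.cons_val_fin_one]

/-! ## §3 The bare-frame vertex profile against `wtₖ` -/

/-- **The `k`-th power weight of the position set of a quartic kernel entry is `1`** (all four legs at one grid point). -/
theorem polyWt_image_eq_one_of_kernel_hubbardGridInteraction_ne_zero (β U β' : ℝ) (k : ℕ) (X : Fin 4 → GridLeg (GridPoint L N))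
    (hX : kernel ℂ (hubbardGridInteraction L N β U) 4 X ≠ 0) :
    diamWeight (fun s => (1 + 1 * s) ^ k) (gridLabelDist L N β') ((univ.image X).image gridLegPos) = 1 := by
  have h := gridLabelWt_image_eq_one_of_kernel_hubbardGridInteraction_ne_zero β β' U X hX
  rw [gridLabelWt_apply] at h
  have hd : labelDiam (gridLabelDist L N β') ((univ.image X).image gridLegPos) = 0 := by linarith
  rw [diamWeight, hd]; norm_num

omit [NeZero N] in
/-- **The bare frame has no grid counterterm**: `𝒩_{0,N} = 0` (`Ǩ_L = 0` for `K = 0`). -/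
theorem hubbardGridCounterQuadratic_frameZero' (β : ℝ) : hubbardGridCounterQuadratic L N β (0 : TrigPolyC4v) = 0 := by
  have hk : ∀ z : TorusSite 2 L, framePosKernel L (0 : TrigPolyC4v) z = 0 := fun z => by simp [framePosKernel]
  simp [hubbardGridCounterQuadratic, hk]

/-- **The `wtₖ`-weighted pinned profile of the bare-frame grid vertex `V_N + 𝒩_{0,N} = V_N`**: `≤ |U||β|/N` in degree `4`, `≤ 0·(…)` in degree `2`,
`0` in every other degree — written in p3's profile shape `(m′ = 1 ↦ (|β|/N)·coeffNorm₀ 0, m′ = 2 ↦ |U||β|/N, else 0)` so that [tree]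
`normV_scaleZeroPinned_eq` applies verbatim. -/
theorem sum_norm_kernel_gridVertex_frameZero_mul_polyWt_le (β U : ℝ) {β' : ℝ} (k : ℕ) (m' : ℕ) (j : Fin (2 * m'))
    (w : GridLeg (GridPoint L N)) :
    ∑ X ∈ univ.filter (fun X : Fin (2 * m') → GridLeg (GridPoint L N) => X j = w),
        ‖kernel ℂ (hubbardGridInteraction L N β U + hubbardGridCounterQuadratic L N β (0 : TrigPolyC4v)) (2 * m') X‖ *
          diamWeight (fun s => (1 + 1 * s) ^ k) (gridLabelDist L N β') ((univ.image X).image gridLegPos) ≤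
      (if m' = 1 then |β| / N * (0 : TrigPolyC4v).coeffNorm 0 else if m' = 2 then |U| * |β| / N else 0 : ℝ) := by
  rw [hubbardGridCounterQuadratic_frameZero', add_zero]
  by_cases h1 : m' = 1
  · -- degree 2: the quartic has no two-leg kernel
    subst h1
    simp only [if_true]
    refine le_of_eq_of_le (sum_eq_zero fun X _ => ?_) (by simp [TrigPolyC4v.coeffNorm])
    rw [kernel_hubbardGridInteraction_of_ne β U (by norm_num) X, norm_zero, zero_mul]
  by_cases h2 : m' = 2
  · -- degree 4: the ultralocal quartic, weight `1` on its support
    subst h2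
    have hk : ∀ X : Fin (2 * 2) → GridLeg (GridPoint L N),
        kernel ℂ (hubbardGridInteraction L N β U) (2 * 2) X = kernel ℂ (hubbardGridInteraction L N β U) 4 X := fun X => rfl
    simp only [if_true, show (2 : ℕ) ≠ 1 by norm_num, if_false, hk]
    refine le_trans (sum_le_sum fun X _ => ?_) (sum_norm_kernel_hubbardGridInteraction_le β U j w)
    by_cases hX : kernel ℂ (hubbardGridInteraction L N β U) 4 X = 0
    · rw [hX, norm_zero, zero_mul]
    · rw [polyWt_image_eq_one_of_kernel_hubbardGridInteraction_ne_zero β U β' k X hX, mul_one]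
  · -- every other degree vanishes
    rw [if_neg h1, if_neg h2]
    refine le_of_eq (sum_eq_zero fun X _ => ?_)
    rw [kernel_hubbardGridInteraction_of_ne β U (by omega) X, norm_zero, zero_mul]

/-! ## §4 The bare-frame sums in closed form (scale `0`, `N = 4M`, `κ₀ = ρ = √(2(7+1606732))`) -/

section BareFrame

variable {M : ℕ} [NeZero M]

/-- Two elementary fraction bounds: `θ ≤ 1/4 ⇒ X/(1−θ) ≤ (4/3)X` and `θ ≤ 1/2 ⇒ X·θ/(1−θ) ≤ 2Xθ` (`X ≥ 0`). -/
theorem div_one_sub_le_of_le_quarter {X θ : ℝ} (hX : 0 ≤ X) (hθ : θ ≤ 1 / 4) : X / (1 - θ) ≤ 4 / 3 * X := by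
  rw [div_le_iff₀ (by linarith)]; nlinarith

/-- `θ ≤ 1/2`, `0 ≤ θ`, `0 ≤ X` ⇒ `X·θ/(1−θ) ≤ 2·X·θ`. -/
theorem mul_div_one_sub_le_of_le_half {X θ : ℝ} (hX : 0 ≤ X) (hθ0 : 0 ≤ θ) (hθ : θ ≤ 1 / 2) : X * θ / (1 - θ) ≤ 2 * X * θ := by
  rw [div_le_iff₀ (by linarith)]; nlinarith [mul_nonneg hX hθ0]

/-- **The vertex size `‖Ṽ‖_h` at the bare frame**: for the p3-shaped profile at `K = 0`,
`normV Γ κ ρ P₀ = (e²(κ+ρ))⁴·(|U||β|/N)` (the quadratic entry vanishes). -/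
theorem normV_frameZero_eq (κ ρ β U : ℝ) :
    normV (GridLeg (GridPoint L (2 * (2 * M)))) κ ρ
        (fun m' => if m' = 1 then |β| / ((2 * (2 * M) : ℕ) : ℝ) * (0 : TrigPolyC4v).coeffNorm 0
          else if m' = 2 then |U| * |β| / ((2 * (2 * M) : ℕ) : ℝ) else 0) =
      (Real.exp 2 * (κ + ρ)) ^ 4 * (|U| * |β| / ((2 * (2 * M) : ℕ) : ℝ)) := by
  haveI : NeZero (2 * (2 * M)) := ⟨by have := NeZero.ne M; omega⟩
  rw [normV_scaleZeroPinned_eq (four_le_card_gridLeg (L := L) (Ng := 2 * (2 * M)))]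
  simp [TrigPolyC4v.coeffNorm]

/-- **`θ` at the bare frame in closed form**: with `κ = ρ = κ₀`, `α = a·N/β` (`β > 0`):
`e·α·normV(P₀)/κ₀² = 16·e⁹·κ₀²·a·|U|`. -/
theorem theta_frameZero_eq {β : ℝ} (hβ : 0 < β) (U a : ℝ) :
    Real.exp 1 * (a * ((2 * (2 * M) : ℕ) : ℝ) / β) *
        normV (GridLeg (GridPoint L (2 * (2 * M)))) (Real.sqrt (2 * (7 + 1606732))) (Real.sqrt (2 * (7 + 1606732)))
          (fun m' => if m' = 1 then |β| / ((2 * (2 * M) : ℕ) : ℝ) * (0 : TrigPolyC4v).coeffNorm 0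
            else if m' = 2 then |U| * |β| / ((2 * (2 * M) : ℕ) : ℝ) else 0) /
        Real.sqrt (2 * (7 + 1606732)) ^ 2 =
      16 * Real.exp 1 ^ 9 * Real.sqrt (2 * (7 + 1606732)) ^ 2 * a * |U| := by
  have hN : (0 : ℝ) < ((2 * (2 * M) : ℕ) : ℝ) := by have := NeZero.ne M; positivity
  have hκ : (0 : ℝ) < Real.sqrt (2 * (7 + 1606732)) := Real.sqrt_pos.2 (by norm_num)
  rw [normV_frameZero_eq (L := L), abs_of_pos hβ]
  have he2 : Real.exp 2 = Real.exp 1 ^ 2 := by rw [← Real.exp_nat_mul]; norm_num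
  rw [he2]; field_simp; ring

/-- **THE PLAIN TWO-LEG SUM AT THE BARE FRAME** (`B₀`): under the regime sizes and `16·e⁹·κ₀²·klScaleZeroA0·|U| ≤ 1/4` (= k3c2-p1's second (E1)₀
smallness `64e⁹κ₀²A₀|U| ≤ 1`), for both spins and every grid point `p₀`:
`Σ_{p₁} ‖kernel₂ (W₀) ((p₀,σ,+),(p₁,σ,−))‖ ≤ (64/3)·e⁹·κ₀²·|U|·β/(4M)`, `W₀ = effAction (S_{4M}ᵀ C⁰_{>e₀} S_{4M}) V_{4M}`. -/
theorem twoLeg_plain_point_sum_frameZero_le {R : RenConsts} (hR : R.WF) (Nsc : ℕ) {μ : ℝ} (hμ : μ ∈ klWindowC) {U : ℝ} (hU : 0 < U)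
    {β : ℝ} (hβ : klBetaMin ≤ β) (hL : klEngL₃ β U ≤ L) (hM : klEngM₃ β U L ≤ M)
    (hsmall : 16 * Real.exp 1 ^ 9 * Real.sqrt (2 * (7 + 1606732)) ^ 2 * klScaleZeroA0 * |U| ≤ 1 / 4)
    (σ : Fin 2) (p₀ : GridPoint L (2 * (2 * M))) :
    ∑ p₁ : GridPoint L (2 * (2 * M)),
      ‖kernel ℂ (effAction ℂ ((hubbardGridSub L M β (2 * (2 * M))).transpose * hubbardCovAboveCT L M β μ 0 0 klE0 *
            hubbardGridSub L M β (2 * (2 * M))) (hubbardGridInteraction L (2 * (2 * M)) β U))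
        2 (fun i => ((![p₀, p₁] i, σ), i))‖ ≤
      64 / 3 * Real.exp 1 ^ 9 * Real.sqrt (2 * (7 + 1606732)) ^ 2 * |U| * (β / ((2 * (2 * M) : ℕ) : ℝ)) := by
  haveI : NeZero (2 * (2 * M)) := ⟨by have := NeZero.ne M; omega⟩
  obtain ⟨hL15, hβL, -, -, hβ3M, -⟩ := scaleZero_regime_sizes (U := U) hβ hL hM
  have hβ0 : 0 < β := lt_of_lt_of_le (by norm_num [klBetaMin]) hβ
  have hN : (0 : ℝ) < ((2 * (2 * M) : ℕ) : ℝ) := by have := NeZero.ne M; positivity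
  have hκ : (0 : ℝ) < Real.sqrt (2 * (7 + 1606732)) := Real.sqrt_pos.2 (by norm_num)
  have hK0 : FrameOK R U Nsc μ 0 := klFrameOK_zeroC hR U Nsc hμ
  have hGB := isGramBoundedR_scaleZero_of_frameOK (L := L) (M := M) hK0 hβ hL15 hβL
  have hA0 : 0 < klScaleZeroA0 := klScaleZeroA0_pos
  have hα : 0 < ((2 * (2 * M) : ℕ) : ℝ) / β * klScaleZeroA0 := by positivity
  have hrow := rowSum_scaleZero_le_A0 (L := L) hK0 hβ hβ3M
  have hcol := colSum_scaleZero_le_A0 (L := L) hK0 hβ hβ3M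
  have hθeq : Real.exp 1 * (((2 * (2 * M) : ℕ) : ℝ) / β * klScaleZeroA0) *
      normV (GridLeg (GridPoint L (2 * (2 * M)))) (Real.sqrt (2 * (7 + 1606732))) (Real.sqrt (2 * (7 + 1606732)))
        (fun m' => if m' = 1 then |β| / ((2 * (2 * M) : ℕ) : ℝ) * (0 : TrigPolyC4v).coeffNorm 0
          else if m' = 2 then |U| * |β| / ((2 * (2 * M) : ℕ) : ℝ) else 0) / Real.sqrt (2 * (7 + 1606732)) ^ 2 =
      16 * Real.exp 1 ^ 9 * Real.sqrt (2 * (7 + 1606732)) ^ 2 * klScaleZeroA0 * |U| := by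
    rw [← theta_frameZero_eq (L := L) (M := M) hβ0 U klScaleZeroA0]
    congr 2
    field_simp
  have hθle : 16 * Real.exp 1 ^ 9 * Real.sqrt (2 * (7 + 1606732)) ^ 2 * klScaleZeroA0 * |U| ≤ 1 / 4 := hsmall
  have hθlt : Real.exp 1 * (((2 * (2 * M) : ℕ) : ℝ) / β * klScaleZeroA0) *
      normV (GridLeg (GridPoint L (2 * (2 * M)))) (Real.sqrt (2 * (7 + 1606732))) (Real.sqrt (2 * (7 + 1606732)))
        (fun m' => if m' = 1 then |β| / ((2 * (2 * M) : ℕ) : ℝ) * (0 : TrigPolyC4v).coeffNorm 0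
          else if m' = 2 then |U| * |β| / ((2 * (2 * M) : ℕ) : ℝ) else 0) / Real.sqrt (2 * (7 + 1606732)) ^ 2 < 1 := by
    rw [hθeq]; exact hθle.trans_lt (by norm_num)
  have h := twoLeg_plain_point_sum_le _ β U (0 : TrigPolyC4v) hκ hGB hα hrow hcol hκ hθlt σ p₀
  rw [hubbardGridCounterQuadratic_frameZero', add_zero, sub_zero] at h
  refine h.trans ?_
  rw [hθeq, normV_frameZero_eq (L := L)]
  have hc0 : (0 : TrigPolyC4v).coeffNorm 0 = 0 := by simp [TrigPolyC4v.coeffNorm]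
  rw [hc0, mul_zero, add_zero]
  have he2 : Real.exp 2 = Real.exp 1 ^ 2 := by rw [← Real.exp_nat_mul]; norm_num
  have hX : 0 ≤ (Real.sqrt (2 * (7 + 1606732)))⁻¹ ^ 2 *
      (Real.exp 1 * ((Real.exp 2 * (Real.sqrt (2 * (7 + 1606732)) + Real.sqrt (2 * (7 + 1606732)))) ^ 4 *
        (|U| * |β| / ((2 * (2 * M) : ℕ) : ℝ)))) := by positivity
  refine (div_one_sub_le_of_le_quarter hX hθle).trans (le_of_eq ?_)
  rw [abs_of_pos hβ0, he2]; field_simp; ring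

/-- **THE OFF-DIAGONAL `k`-TH MOMENT SUM AT THE BARE FRAME** (`Bₖ`, every `k`): with `a` the NORMALISED `wtₖ`-weighted row/column size of the bare
scale-`0` grid covariance (`Σ_Y ‖C X Y‖·(1+diam{X,Y})ᵏ ≤ a·N/β`, `N = 4M`) and the smallness `16·e⁹·κ₀²·a·|U| ≤ 1/2` (`= θ ≤ 1/2`):
`Σ_{p₁} [x⃗₁ ≠ x⃗₀](1+|Δx̃₀|+|Δx̃₁|)ᵏ‖kernel₂ (W₀) ((p₀,σ,+),(p₁,σ,−))‖ ≤ 2^{k+9}·e¹⁸·κ₀⁴·a·U²·β/(4M)` — PURE `U²`, `M`-uniform. -/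
theorem twoLeg_offDiag_moment_pow_sum_frameZero_le {R : RenConsts} (hR : R.WF) (Nsc : ℕ) {μ : ℝ} (hμ : μ ∈ klWindowC) {U : ℝ}
    (hU : 0 < U) {β : ℝ} (hβ : klBetaMin ≤ β) (hL : klEngL₃ β U ≤ L) (hM : klEngM₃ β U L ≤ M) (k : ℕ) {a : ℝ} (ha : 0 < a)
    (hrow : ∀ X, ∑ Y, ‖((hubbardGridSub L M β (2 * (2 * M))).transpose * hubbardCovAboveCT L M β μ 0 0 klE0 *
        hubbardGridSub L M β (2 * (2 * M))) X Y‖ *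
        diamWeight (fun s => (1 + 1 * s) ^ k) (gridLabelDist L (2 * (2 * M)) β) {gridLegPos X, gridLegPos Y} ≤
          a * ((2 * (2 * M) : ℕ) : ℝ) / β)
    (hcol : ∀ Y, ∑ X, ‖((hubbardGridSub L M β (2 * (2 * M))).transpose * hubbardCovAboveCT L M β μ 0 0 klE0 *
        hubbardGridSub L M β (2 * (2 * M))) X Y‖ *
        diamWeight (fun s => (1 + 1 * s) ^ k) (gridLabelDist L (2 * (2 * M)) β) {gridLegPos X, gridLegPos Y} ≤
          a * ((2 * (2 * M) : ℕ) : ℝ) / β)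
    (hsmall : 16 * Real.exp 1 ^ 9 * Real.sqrt (2 * (7 + 1606732)) ^ 2 * a * |U| ≤ 1 / 2)
    (σ : Fin 2) (p₀ : GridPoint L (2 * (2 * M))) :
    ∑ p₁ : GridPoint L (2 * (2 * M)), (if p₁.2 - p₀.2 = 0 then (0 : ℝ) else
        (1 + (((p₁.2 - p₀.2) 0).valMinAbs.natAbs : ℝ) + (((p₁.2 - p₀.2) 1).valMinAbs.natAbs : ℝ)) ^ k) *
      ‖kernel ℂ (effAction ℂ ((hubbardGridSub L M β (2 * (2 * M))).transpose * hubbardCovAboveCT L M β μ 0 0 klE0 *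
            hubbardGridSub L M β (2 * (2 * M))) (hubbardGridInteraction L (2 * (2 * M)) β U))
        2 (fun i => ((![p₀, p₁] i, σ), i))‖ ≤
      (2 : ℝ) ^ (k + 9) * Real.exp 1 ^ 18 * Real.sqrt (2 * (7 + 1606732)) ^ 4 * a * U ^ 2 * (β / ((2 * (2 * M) : ℕ) : ℝ)) := by
  haveI : NeZero (2 * (2 * M)) := ⟨by have := NeZero.ne M; omega⟩
  obtain ⟨hL15, hβL, -, -, -, -⟩ := scaleZero_regime_sizes (U := U) hβ hL hM
  have hβ0 : 0 < β := lt_of_lt_of_le (by norm_num [klBetaMin]) hβ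
  have hN : (0 : ℝ) < ((2 * (2 * M) : ℕ) : ℝ) := by have := NeZero.ne M; positivity
  have hκ : (0 : ℝ) < Real.sqrt (2 * (7 + 1606732)) := Real.sqrt_pos.2 (by norm_num)
  have hK0 : FrameOK R U Nsc μ 0 := klFrameOK_zeroC hR U Nsc hμ
  have hGB := isGramBoundedR_scaleZero_of_frameOK (L := L) (M := M) hK0 hβ hL15 hβL
  have hα : 0 < a * ((2 * (2 * M) : ℕ) : ℝ) / β := by positivity
  have hθeq := theta_frameZero_eq (L := L) (M := M) hβ0 U a
  have hθ0 : 0 ≤ 16 * Real.exp 1 ^ 9 * Real.sqrt (2 * (7 + 1606732)) ^ 2 * a * |U| := by positivity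
  have hθle : 16 * Real.exp 1 ^ 9 * Real.sqrt (2 * (7 + 1606732)) ^ 2 * a * |U| ≤ 1 / 2 := hsmall
  have hθlt : Real.exp 1 * (a * ((2 * (2 * M) : ℕ) : ℝ) / β) *
      normV (GridLeg (GridPoint L (2 * (2 * M)))) (Real.sqrt (2 * (7 + 1606732))) (Real.sqrt (2 * (7 + 1606732)))
        (fun m' => if m' = 1 then |β| / ((2 * (2 * M) : ℕ) : ℝ) * (0 : TrigPolyC4v).coeffNorm 0
          else if m' = 2 then |U| * |β| / ((2 * (2 * M) : ℕ) : ℝ) else 0) / Real.sqrt (2 * (7 + 1606732)) ^ 2 < 1 := by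
    rw [hθeq]; exact hθle.trans_lt (by norm_num)
  have hP0 : ∀ m', 0 ≤ (if m' = 1 then |β| / ((2 * (2 * M) : ℕ) : ℝ) * (0 : TrigPolyC4v).coeffNorm 0
      else if m' = 2 then |U| * |β| / ((2 * (2 * M) : ℕ) : ℝ) else 0 : ℝ) := fun m' => by
    have := TrigPolyC4v.coeffNorm_nonneg 0 (0 : TrigPolyC4v); split_ifs <;> positivity
  have h := twoLeg_offDiag_moment_pow_sum_le _ β U (0 : TrigPolyC4v) k hβ0.le hκ hGB _ hP0
    (sum_norm_kernel_gridVertex_frameZero_mul_polyWt_le β U k) hα hrow hcol hκ hθlt σ p₀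
  rw [hubbardGridCounterQuadratic_frameZero', add_zero, sub_zero] at h
  refine h.trans ?_
  rw [hθeq]
  have hnV := normV_frameZero_eq (L := L) (M := M) (Real.sqrt (2 * (7 + 1606732))) (Real.sqrt (2 * (7 + 1606732))) β U
  rw [hnV]
  have he2 : Real.exp 2 = Real.exp 1 ^ 2 := by rw [← Real.exp_nat_mul]; norm_num
  simp only [abs_of_pos hβ0, abs_of_pos hU] at hθ0 hθle ⊢
  have hX : 0 ≤ (2 : ℝ) ^ k * ((Real.sqrt (2 * (7 + 1606732)))⁻¹ ^ 2 *
      (Real.exp 1 * ((Real.exp 2 * (Real.sqrt (2 * (7 + 1606732)) + Real.sqrt (2 * (7 + 1606732)))) ^ 4 *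
        (U * β / ((2 * (2 * M) : ℕ) : ℝ))))) := by positivity
  rw [show ∀ A B θ : ℝ, A * (B * θ / (1 - θ)) = (A * B) * θ / (1 - θ) from fun A B θ => by ring]
  refine (mul_div_one_sub_le_of_le_half hX hθ0 hθle).trans (le_of_eq ?_)
  rw [he2, pow_add]; field_simp; ring

/-- **The `gridLabelWt`-weighted pinned profile of the bare-frame grid vertex** (weight `1 + diam`, the W-chain's `wt₁`), p3's profile shape. -/
theorem sum_norm_kernel_gridVertex_frameZero_mul_gridLabelWt_le (β U β' : ℝ) (m' : ℕ) (j : Fin (2 * m')) (w : GridLeg (GridPoint L N)) :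
    ∑ X ∈ univ.filter (fun X : Fin (2 * m') → GridLeg (GridPoint L N) => X j = w),
        ‖kernel ℂ (hubbardGridInteraction L N β U + hubbardGridCounterQuadratic L N β (0 : TrigPolyC4v)) (2 * m') X‖ *
          gridLabelWt L N β' ((univ.image X).image gridLegPos) ≤
      (if m' = 1 then |β| / N * (0 : TrigPolyC4v).coeffNorm 0 else if m' = 2 then |U| * |β| / N else 0 : ℝ) := by
  have h := sum_norm_kernel_gridVertex_frameZero_mul_polyWt_le (L := L) (N := N) β U (β' := β') 1 m' j w
  refine le_trans (le_of_eq (sum_congr rfl fun X _ => ?_)) h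
  rw [diamWeight, gridLabelWt_apply, one_mul, pow_one]

/-- **THE TEMPORAL FIRST MOMENT SUM AT THE BARE FRAME** (`Bᵗ`, circular grid distance, weight `wt₁ = 1 + diam` at `β′ = β`): with `a` the normalised
`wt₁`-weighted covariance size and `16·e⁹·κ₀²·a·|U| ≤ 1/2`:
`Σ_{p₁} (β/4M)·circDist_{4M}(j₀,j₁)·‖kernel₂ (W₀) ((p₀,σ,+),(p₁,σ,−))‖ ≤ 2⁹·e¹⁸·κ₀⁴·a·U²·β/(4M)`. -/
theorem twoLeg_time_sum_frameZero_le {R : RenConsts} (hR : R.WF) (Nsc : ℕ) {μ : ℝ} (hμ : μ ∈ klWindowC) {U : ℝ}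
    (hU : 0 < U) {β : ℝ} (hβ : klBetaMin ≤ β) (hL : klEngL₃ β U ≤ L) (hM : klEngM₃ β U L ≤ M) {a : ℝ} (ha : 0 < a)
    (hrow : ∀ X, ∑ Y, ‖((hubbardGridSub L M β (2 * (2 * M))).transpose * hubbardCovAboveCT L M β μ 0 0 klE0 *
        hubbardGridSub L M β (2 * (2 * M))) X Y‖ * gridLabelWt L (2 * (2 * M)) β {gridLegPos X, gridLegPos Y} ≤
          a * ((2 * (2 * M) : ℕ) : ℝ) / β)
    (hcol : ∀ Y, ∑ X, ‖((hubbardGridSub L M β (2 * (2 * M))).transpose * hubbardCovAboveCT L M β μ 0 0 klE0 *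
        hubbardGridSub L M β (2 * (2 * M))) X Y‖ * gridLabelWt L (2 * (2 * M)) β {gridLegPos X, gridLegPos Y} ≤
          a * ((2 * (2 * M) : ℕ) : ℝ) / β)
    (hsmall : 16 * Real.exp 1 ^ 9 * Real.sqrt (2 * (7 + 1606732)) ^ 2 * a * |U| ≤ 1 / 2)
    (σ : Fin 2) (p₀ : GridPoint L (2 * (2 * M))) :
    ∑ p₁ : GridPoint L (2 * (2 * M)), β / ((2 * (2 * M) : ℕ) : ℝ) * (circDist (2 * (2 * M)) p₀.1.val p₁.1.val : ℝ) *
      ‖kernel ℂ (effAction ℂ ((hubbardGridSub L M β (2 * (2 * M))).transpose * hubbardCovAboveCT L M β μ 0 0 klE0 *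
            hubbardGridSub L M β (2 * (2 * M))) (hubbardGridInteraction L (2 * (2 * M)) β U))
        2 (fun i => ((![p₀, p₁] i, σ), i))‖ ≤
      (2 : ℝ) ^ 9 * Real.exp 1 ^ 18 * Real.sqrt (2 * (7 + 1606732)) ^ 4 * a * U ^ 2 * (β / ((2 * (2 * M) : ℕ) : ℝ)) := by
  haveI : NeZero (2 * (2 * M)) := ⟨by have := NeZero.ne M; omega⟩
  obtain ⟨hL15, hβL, -, -, -, -⟩ := scaleZero_regime_sizes (U := U) hβ hL hM
  have hβ0 : 0 < β := lt_of_lt_of_le (by norm_num [klBetaMin]) hβ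
  have hN : (0 : ℝ) < ((2 * (2 * M) : ℕ) : ℝ) := by have := NeZero.ne M; positivity
  have hκ : (0 : ℝ) < Real.sqrt (2 * (7 + 1606732)) := Real.sqrt_pos.2 (by norm_num)
  have hK0 : FrameOK R U Nsc μ 0 := klFrameOK_zeroC hR U Nsc hμ
  have hGB := isGramBoundedR_scaleZero_of_frameOK (L := L) (M := M) hK0 hβ hL15 hβL
  have hα : 0 < a * ((2 * (2 * M) : ℕ) : ℝ) / β := by positivity
  have hθeq := theta_frameZero_eq (L := L) (M := M) hβ0 U a
  have hθ0 : 0 ≤ 16 * Real.exp 1 ^ 9 * Real.sqrt (2 * (7 + 1606732)) ^ 2 * a * |U| := by positivity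
  have hθle : 16 * Real.exp 1 ^ 9 * Real.sqrt (2 * (7 + 1606732)) ^ 2 * a * |U| ≤ 1 / 2 := hsmall
  have hθlt : Real.exp 1 * (a * ((2 * (2 * M) : ℕ) : ℝ) / β) *
      normV (GridLeg (GridPoint L (2 * (2 * M)))) (Real.sqrt (2 * (7 + 1606732))) (Real.sqrt (2 * (7 + 1606732)))
        (fun m' => if m' = 1 then |β| / ((2 * (2 * M) : ℕ) : ℝ) * (0 : TrigPolyC4v).coeffNorm 0
          else if m' = 2 then |U| * |β| / ((2 * (2 * M) : ℕ) : ℝ) else 0) / Real.sqrt (2 * (7 + 1606732)) ^ 2 < 1 := by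
    rw [hθeq]; exact hθle.trans_lt (by norm_num)
  have hP0 : ∀ m', 0 ≤ (if m' = 1 then |β| / ((2 * (2 * M) : ℕ) : ℝ) * (0 : TrigPolyC4v).coeffNorm 0
      else if m' = 2 then |U| * |β| / ((2 * (2 * M) : ℕ) : ℝ) else 0 : ℝ) := fun m' => by
    have := TrigPolyC4v.coeffNorm_nonneg 0 (0 : TrigPolyC4v); split_ifs <;> positivity
  have h := twoLeg_time_sum_le _ β U (0 : TrigPolyC4v) hβ0.le hκ hGB _ hP0
    (sum_norm_kernel_gridVertex_frameZero_mul_gridLabelWt_le β U β) hα hrow hcol hκ hθlt σ p₀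
  rw [hubbardGridCounterQuadratic_frameZero', add_zero, sub_zero] at h
  refine h.trans ?_
  rw [hθeq]
  have hnV := normV_frameZero_eq (L := L) (M := M) (Real.sqrt (2 * (7 + 1606732))) (Real.sqrt (2 * (7 + 1606732))) β U
  rw [hnV]
  have he2 : Real.exp 2 = Real.exp 1 ^ 2 := by rw [← Real.exp_nat_mul]; norm_num
  simp only [abs_of_pos hβ0, abs_of_pos hU] at hθ0 hθle ⊢
  have hX : 0 ≤ ((Real.sqrt (2 * (7 + 1606732)))⁻¹ ^ 2 *
      (Real.exp 1 * ((Real.exp 2 * (Real.sqrt (2 * (7 + 1606732)) + Real.sqrt (2 * (7 + 1606732)))) ^ 4 *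
        (U * β / ((2 * (2 * M) : ℕ) : ℝ))))) := by positivity
  refine (mul_div_one_sub_le_of_le_half hX hθ0 hθle).trans (le_of_eq ?_)
  rw [he2]; field_simp; ring

end BareFrame

end Summit.HubbardSuperconductivity.HubbardSuperconductivity.Theorems.EngineV8

end
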